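import Literature.Geometry.Lorentzian.Stability
import Literature.Geometry.Lorentzian.CauchyDevelopment
import HarnessLib

/-!
# gr.S05 over the repaired development structure: Klainerman–Szeftel, faithful consequence form

`Literature.Geometry.Lorentzian.Stability` vendors the nonlinear stability of slowly rotating Kerr
black holes (Klainerman–Szeftel, PAMQ 19 (2023) = arXiv:2104.11857, with Giorgi–Klainerman–Szeftel
arXiv:2205.14808 and Shen arXiv:2205.12336) as the named fact
`klainerman_szeftel_kerr_stability_small_a` (gr.S05). The audit of that `def` against the source
by its tenure holder (2026-08-15; recorded with the vacuous discharge
`klainerman_szeftel_kerr_stability_small_a_holds` in `StabilityProofs`) found two defects, which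
this file repairs **under new names** (D-0014: no in-place change of meaning; the old `def` and its
users are untouched):

1. **Vacuity (structural).** All content of the `def` sits under `∀ 𝒟 : VacuumDevelopment D`, and
   the vendored `Development D` is uninhabited (`Literature.Geometry.Lorentzian.Development.elim`,
   `DevelopmentProofs`; knock-on of the misformalised `LorentzianMetric.IsCauchySurface`,
   `CausalityProofs`). `CauchyDevelopment.lean` carries the repair — `DataEmbedding`,
   `CauchyDevelopment`, `VacuumCauchyDevelopment`, `VacuumCauchyDevelopment.IsMaximal` over the
   corrected `LorentzianMetric.IsCauchyHypersurface` — and its porting guide assigns the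
   re-vendoring of gr.S04–gr.S07 over it to the respective tenure holders. This file does gr.S05:
   the sojourn-form completeness notions `Development.HasCompleteFutureNullInfinity(From)`
   (`NullInfinity`, `Stability`) and `HasCompleteFutureNullInfinityFar` (`Stability`) are ported
   verbatim to `DataEmbedding` (they use only the fields `(M, g, τ, ι, ν)`, so they serve
   `CauchyDevelopment`/`VacuumCauchyDevelopment` through the parent projections and also the
   existence-form statements over bare data embeddings announced in `CauchyDevelopment.lean`), and
   the fact is re-stated over `VacuumCauchyDevelopment D`, `IsMaximal`.
2. **Parameter modulus (content).** The `def` concludes `|M' − M| + |a' − a| ≤ C · dist(D, Kerr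
   data)`, *linear* in the data distance. The printed Main Theorem (version 2), §3.4.3, assumes
   (3.4.7) `𝔍_{k_large+10} ≤ ε₀²` — (ε₀, k)-admissibility of the initial data layer, Def. 3.4.2 —
   and concludes (3.4.8) `𝔑^{(Sup)}_{k_large} + 𝔑^{(Dec)}_{k_small} + |a_∞ − a₀| + |m_∞ − m₀| ≤ C ε₀`;
   the initial layer norm `𝔍_k` (§3.3.6) is a weighted sup norm of the linearised Ricci
   coefficients `Γ_g, Γ_b` and curvature components `A, B`, i.e. *linear* in the perturbation, so
   relative to any data norm comparable to `𝔍` the printed modulus is `C √·` (KS, footnote to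
   (3.4.7) and Remark 3.4.8, expect but do not prove the hypothesis `𝔍 ≤ ε₀`). The re-vendored
   fact carries `≤ C · √dist`, exactly as the sibling fixed-exponent rendering
   `klainerman_szeftel_kerr_stability` of `Sweep1`; the qualitative "`(a_∞, m_∞)` close to
   `(a₀, m₀)`" of Thm. 1.2.1 is derived from it (`…_cauchy.nearness`).

Everything else is verbatim gr.S05 of `Stability.lean` (same docstring conventions, same
consequence-form paraphrase accepted there: existential exponents `(s, δ)` and order `k`, universal
`a₀`, `ε, C` depending on `(M, a, r₀)`, horizon-penetrating truncated Kerr–Schild slices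
`Kerr.slice a r₀`, far-origin completeness of `𝓘⁺`, `Spacetime.ConvergesToKerr` with existential
region `𝒟oc`, standing hypotheses `[Kerr.Facts] [Kerr.SliceFacts] [D.metric.HasLeviCivita]`).

## Main definitions and results

* `DataEmbedding.HasCompleteFutureNullInfinityFrom 𝒮 A`,
  `DataEmbedding.HasCompleteFutureNullInfinity 𝒮` (ports of the `Development` notions; proved:
  `_univ`, `.anti`, `.hasCompleteFutureNullInfinityFrom`);
  `DataEmbedding.HasCompleteFutureNullInfinityFar 𝒮` for data on `Kerr.slice a r₀` (port of
  `HasCompleteFutureNullInfinityFar`; proved: `_iff`, `_of_hasCompleteFutureNullInfinity`).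
* `klainerman_szeftel_kerr_stability_small_a_cauchy` — gr.S05 re-vendored (named fact), with the
  proved corollaries `.nearness` (the `∀ η > 0, ∃ ε > 0` form of Thm. 1.2.1) and `.atKerrData` (at
  the centre of the data ball the final parameters are `(M, a)`: complete far `𝓘⁺` and
  `ConvergesToKerr … M a k` for every maximal vacuum Cauchy development of the exact Kerr data,
  given the two named facts about `Kerr.data` it consumes, as in
  `SubextremalKerrStabilityConjecture.kerr_hasCompleteFutureNullInfinityFar`).

## What is deliberately not here

No change to `Stability.lean`; no port of gr.S04/gr.S06/gr.S07 or of
`kerr_hasCompleteFutureNullInfinityFar` (other tenures); no isometry-invariance fact for the ported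
notions (the `Development` one is itself only vacuously discharged, `StabilityProofs`); no claim
that the printed proof is formalised — the fact stays a named fact (the printed proof, KS 2023
Theorems M0–M8, §3.7, with the GCM papers and GKS 2022, has no carrier in the prelude: PG/PT
frames, GCM spheres and hypersurfaces, the norms `𝔑`, `𝔍`, the `r^p`/Morawetz estimates for the
generalised Regge–Wheeler system).

## References

* S. Klainerman, J. Szeftel, *Kerr stability for small angular momentum*, Pure Appl. Math. Q. 19
  (2023) 791–1678 = arXiv:2104.11857 [held, corpus-tex]: Thm. 1.2.1 (Main Theorem, first version,
  §1.2.1; arXiv v1 p. 22); §3.1.1, §3.2.1 (the boundaries `𝓐₀ = {r = r₊(1 − 2δ_ℋ)}`,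
  `𝓐 = {r = r₊(1 − δ_ℋ)}`); §3.3.6 (initial layer norm `𝔍_k`); §3.4.1 (smallness constants);
  Def. 3.4.2 ((ε₀, k)-admissible layer: `𝔍_k ≤ ε₀²`), Remark 3.4.3 (classes of
  Cauchy data generating admissible layers: Klainerman–Nicolò, Caciotta–Nicolò), Def. 3.4.4–3.4.5
  (future development of a layer; admissible future null complete spacetime: "The future null
  infinity `𝓘⁺` of `𝓜` is complete"); Main Theorem (version 2), §3.4.3 (arXiv v1 p. 138),
  (3.4.7)–(3.4.8) and items 1–5 (Bondi mass, angular momentum, coordinate systems with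
  `g = g_{a_∞,m_∞} + O(ε₀ u^{-1-δ_dec})`); Remark 3.4.8 (the weaker hypothesis
  `𝔍_{k_large+10} ≤ ε₀`, `^{(ext)}𝔍_3 ≤ ε₀²` suffices). Bib key `KlainermanSzeftel2023`.
* E. Giorgi, S. Klainerman, J. Szeftel, *Wave equations estimates and the nonlinear stability of
  slowly rotating Kerr black holes*, arXiv:2205.14808, §1.5.4. Bib key `GiorgiKlainermanSzeftel2022`.
* D. Shen, *Construction of GCM hypersurfaces in perturbations of Kerr*, arXiv:2205.12336.
* M. Dafermos, I. Rodnianski, *Lectures on black holes and linear waves*, arXiv:0811.0354, §2.6.2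
  (Christodoulou's formulation of complete `𝓘⁺`), §5.1, Conj. 5.1.
* D. Christodoulou, *On the global initial value problem and the issue of singularities*, CQG 16
  (1999) A23–A35, pp. A26–A27.
* Y. Choquet-Bruhat, R. Geroch, Comm. Math. Phys. 14 (1969) 329–335, Thm. 3 (MGHD).
-/

noncomputable section

open Set TopologicalSpace Filter
open scoped ContDiff ENNReal Manifold Topology

universe u

/-! ### Complete `𝓘⁺` (sojourn form) for data embeddings -/

namespace Literature.Geometry.Lorentzian.DataEmbedding

variable {n : ℕ} {X' : Type u} [TopologicalSpace X'] [ChartedSpace (EuclideanSpace ℝ (Fin n)) X']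
  [IsManifold (𝓡 n) ∞ X'] [ConnectedSpace X'] {D : InitialDataSet (𝓡 n) X'}

/-- The data embedding `𝒮 = (M, g, τ, ι, ν)` of `D` **has complete future null infinity as seen
from the ray origins `A ⊆ X`** (Christodoulou's sojourn form with restricted origins): there is
a compact `B₀ ⊆ X` such that for every `s > 0` there is a compact `B₁ ⊆ X` such that every
normalised future null ray starting at a point `p ∈ A ∖ B₁` is future complete or spends affine
time `≥ s` in `J⁺(ι B₀)`. Verbatim port of `Development.HasCompleteFutureNullInfinityFrom`
(`Stability`) from the defective `Development` to `DataEmbedding` (`CauchyDevelopment.lean`); it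
uses only the fields `(M, g, τ, ι, ν)` and therefore applies to `CauchyDevelopment` /
`VacuumCauchyDevelopment` through the parent projections. The standing Levi-Civita hypothesis
`[g.HasLeviCivita]` of the null-ray notions is bound inside, as there. Christodoulou, CQG 16
(1999) A23, pp. A26–A27; Dafermos–Rodnianski, arXiv:0811.0354,
§2.6.2. [cite: DafermosRodnianski2008, §2.6.2] -/
def HasCompleteFutureNullInfinityFrom (𝒮 : DataEmbedding D) (A : Set X') : Prop :=
  ∀ [𝒮.metric.HasLeviCivita],
    ∃ B₀ : Set X', IsCompact B₀ ∧ ∀ s : ℝ, 0 < s → ∃ B₁ : Set X', IsCompact B₁ ∧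
      ∀ p ∈ A, p ∉ B₁ → ∀ (γ : ℝ → 𝒮.carrier) (dom : Set ℝ),
        𝒮.metric.IsNormalisedNullRayFrom 𝒮.timeOrientation 𝒮.embed 𝒮.normal p γ dom →
          ¬ BddAbove dom ∨ ENNReal.ofReal s ≤
            sojournTime γ dom (𝒮.metric.causalFuture 𝒮.timeOrientation (𝒮.embed '' B₀))

/-- The data embedding `𝒮` **has complete future null infinity** in Christodoulou's intrinsic
sojourn sense (all of `X` as ray origins): verbatim port of
`Development.HasCompleteFutureNullInfinity` (`NullInfinity`) to `DataEmbedding`, i.e.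
`LorentzianMetric.HasCompleteFutureNullInfinity` for `(g, τ, ι, ν)` under the standing hypothesis
`[g.HasLeviCivita]` bound inside. Christodoulou,
CQG 16 (1999) A23, pp. A26–A27; Dafermos–Rodnianski, arXiv:0811.0354,
§2.6.2. [cite: DafermosRodnianski2008, §2.6.2] -/
def HasCompleteFutureNullInfinity (𝒮 : DataEmbedding D) : Prop :=
  ∀ [𝒮.metric.HasLeviCivita],
    𝒮.metric.HasCompleteFutureNullInfinity 𝒮.timeOrientation 𝒮.embed 𝒮.normal

/-- With all of `X` as ray origins, `HasCompleteFutureNullInfinityFrom` is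
`HasCompleteFutureNullInfinity` (Dafermos–Rodnianski, arXiv:0811.0354, §2.6.2). [folklore] -/
theorem hasCompleteFutureNullInfinityFrom_univ (𝒮 : DataEmbedding D) :
    𝒮.HasCompleteFutureNullInfinityFrom univ ↔ 𝒮.HasCompleteFutureNullInfinity := by
  simp only [HasCompleteFutureNullInfinityFrom, mem_univ, true_imp_iff,
    HasCompleteFutureNullInfinity, LorentzianMetric.HasCompleteFutureNullInfinity]

/-- `HasCompleteFutureNullInfinityFrom` is antitone in the set of ray origins
(Dafermos–Rodnianski, arXiv:0811.0354, §2.6.2). [folklore] -/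
theorem HasCompleteFutureNullInfinityFrom.anti {𝒮 : DataEmbedding D} {A A' : Set X'}
    (h : 𝒮.HasCompleteFutureNullInfinityFrom A') (hA : A ⊆ A') :
    𝒮.HasCompleteFutureNullInfinityFrom A := by
  intro _
  obtain ⟨B₀, hB₀, hs⟩ := h
  refine ⟨B₀, hB₀, fun s hs' ↦ ?_⟩
  obtain ⟨B₁, hB₁, hp⟩ := hs s hs'
  exact ⟨B₁, hB₁, fun p hpA hpB ↦ hp p (hA hpA) hpB⟩

/-- Complete future null infinity (all origins) implies the restricted-origin version for every
`A` (Dafermos–Rodnianski, arXiv:0811.0354, §2.6.2). [folklore] -/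
theorem HasCompleteFutureNullInfinity.hasCompleteFutureNullInfinityFrom {𝒮 : DataEmbedding D}
    (h : 𝒮.HasCompleteFutureNullInfinity) (A : Set X') :
    𝒮.HasCompleteFutureNullInfinityFrom A :=
  have h' : 𝒮.HasCompleteFutureNullInfinityFrom univ :=
    (hasCompleteFutureNullInfinityFrom_univ 𝒮).2 h
  h'.anti (subset_univ A)

end Literature.Geometry.Lorentzian.DataEmbedding

namespace Literature.Geometry.Lorentzian

/-! ### Far-origin completeness on the truncated Kerr–Schild slices -/

/-- **Complete `𝓘⁺` as seen from the closed far region, for data embeddings of data on the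
truncated Kerr–Schild slices** `Kerr.slice a r₀ = {t* = 0} ∩ {r > r₀} ⊆ E3`: the sojourn form with
ray origins restricted to `Kerr.farSlice a r₀ = {R + 1 ≤ ‖y‖}` (as a subset of the slice,
`range (Kerr.farSliceIncl a r₀)`), whose only end is the asymptotically flat one. Verbatim port of
`HasCompleteFutureNullInfinityFar` (`Stability`, where the reason for the restriction is recorded:
the unrestricted notion fails near the artificial inner edge `{r = r₀}` for every development) from
`Development` to `DataEmbedding`. `[Kerr.SliceFacts]` supplies connectedness of the slice.
Dafermos–Rodnianski, arXiv:0811.0354, §2.6.2 and §5.1. [cite: DafermosRodnianski2008, §2.6.2] -/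
def DataEmbedding.HasCompleteFutureNullInfinityFar [Kerr.SliceFacts] {a r₀ : ℝ}
    {D : InitialDataSet 𝓘(ℝ, E3) (Kerr.slice a r₀)} (𝒮 : DataEmbedding D) : Prop :=
  𝒮.HasCompleteFutureNullInfinityFrom (range (Kerr.farSliceIncl a r₀))

/-- Unfolding lemma for `DataEmbedding.HasCompleteFutureNullInfinityFar` (Dafermos–Rodnianski,
arXiv:0811.0354, §2.6.2). [folklore] -/
theorem DataEmbedding.hasCompleteFutureNullInfinityFar_iff [Kerr.SliceFacts] {a r₀ : ℝ}
    {D : InitialDataSet 𝓘(ℝ, E3) (Kerr.slice a r₀)} (𝒮 : DataEmbedding D) :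
    𝒮.HasCompleteFutureNullInfinityFar ↔
      𝒮.HasCompleteFutureNullInfinityFrom (range (Kerr.farSliceIncl a r₀)) :=
  Iff.rfl

/-- The unrestricted notion implies the far one (formally; on `Kerr.slice a r₀` the hypothesis is
never satisfied, see `HasCompleteFutureNullInfinityFar` in `Stability`). Dafermos–Rodnianski,
arXiv:0811.0354, §2.6.2. [folklore] -/
theorem DataEmbedding.hasCompleteFutureNullInfinityFar_of_hasCompleteFutureNullInfinity
    [Kerr.SliceFacts] {a r₀ : ℝ} {D : InitialDataSet 𝓘(ℝ, E3) (Kerr.slice a r₀)}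
    {𝒮 : DataEmbedding D} (h : 𝒮.HasCompleteFutureNullInfinity) :
    𝒮.HasCompleteFutureNullInfinityFar :=
  h.hasCompleteFutureNullInfinityFrom _

/-! ### gr.S05 re-vendored: Klainerman–Szeftel over `VacuumCauchyDevelopment` -/

/-- **gr.S05, faithful consequence form** (nonlinear stability of slowly rotating Kerr; named
fact, D-0014; corrected re-vendoring of `klainerman_szeftel_kerr_stability_small_a` of
`Stability`, see the module docstring for the two discrepancies it repairs). **Source.**
Klainerman–Szeftel, *Kerr stability for small angular momentum*, PAMQ 19 (2023) 791–1678 =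
arXiv:2104.11857, Thm. 1.2.1 (Main Theorem, first version, §1.2.1): "The future globally
hyperbolic development of a general, asymptotically flat, initial data set, sufficiently close
(in a suitable topology) to a `Kerr(a₀, m₀)` initial data set, for sufficiently small `a₀/m₀`,
has a complete future null infinity `𝓘⁺` and converges in its causal past `𝓙⁻¹(𝓘⁺)` [sic] to
another nearby Kerr spacetime `Kerr(a_∞, m_∞)` with parameters `(a_∞, m_∞)` close to the initial
ones `(a₀, m₀)`"; precise version: Main Theorem (version 2), §3.4.3: for an
`(ε₀, k_large + 10)`-admissible initial data layer `𝓛(a₀, m₀)` (Def. 3.4.2), `|a₀|/m₀`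
sufficiently small, `k_large` sufficiently large, `ε₀` sufficiently small, (3.4.7)
`𝔍_{k_large+10} ≤ ε₀²`, there are an admissible future complete development `𝓜_∞` (Def. 3.4.5:
"The future null infinity `𝓘⁺` of `𝓜` is complete") and constants `(a_∞, m_∞)` with (3.4.8)
`𝔑^{(Sup)}_{k_large} + 𝔑^{(Dec)}_{k_small} + |a_∞ − a₀| + |m_∞ − m₀| ≤ C ε₀`, and (items 3–4)
coordinate systems covering `𝓜_ext`, `𝓜_int` in which `g = g_{a_∞,m_∞} + O(ε₀ u^{-1-δ_dec})`,
with `𝔡^{≤ k_small}` derivatives. Completed by Giorgi–Klainerman–Szeftel, arXiv:2205.14808, and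
Shen, arXiv:2205.12336.

**Statement.** There are `(s, δ, k)` and a universal `a₀ > 0` such that for all Kerr parameters
`0 < M`, `|a| < a₀ M` and every inner radius `r₀ ∈ (r₋, r₊)` (horizon-penetrating Kerr–Schild
slice `Kerr.slice a r₀ = {t* = 0} ∩ {r > r₀}`) there are `ε > 0` and `C` with: for every solution
`D` of the vacuum constraints on `Kerr.slice a r₀` which is `ε`-close to the induced Kerr data
`Kerr.data M a r₀` in `H^s_δ × H^{s-1}_{δ+1}` (`dataWeightedSobolevEDist`), every **maximal vacuum
Cauchy development** `𝒟 : VacuumCauchyDevelopment D`, `𝒟.IsMaximal` (the repaired MGHD notion of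
`CauchyDevelopment.lean`) has complete future null infinity as seen from the closed far region
(`DataEmbedding.HasCompleteFutureNullInfinityFar`), possesses a region `𝒟oc` converging in `Cᵏ`
to a subextremal Kerr exterior `g_{M',a'}` (`Spacetime.ConvergesToKerr`), and
`|M' − M| + |a' − a| ≤ C · √dist(D, Kerr.data M a r₀)`.

Paraphrase notes. As in `Stability` (OUTLINE §4.4): `a₀` is uniform in `M` by scale invariance
while `ε, C` depend on `(M, a, r₀)` (the initial layer and `𝓜_int` reach inside the horizon to
`r = r₊(1 − 2δ_ℋ)`, `r = r₊(1 − δ_ℋ)`, §3.1.1, §3.2.1, so for `r₀` close to `r₊` the small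
constant `δ_ℋ` of §3.4.1 is taken `< (1 − r₀/r₊)/2` and `ε ≪ δ_ℋ` depends on `r₀`); the printed
theorem is formulated for the initial data layer in PG/PT gauges with quantitative decay, of which
this is the consequence form for Cauchy data (KS, Remark 3.4.3: the classes of Cauchy data
generating admissible layers are those of Klainerman–Nicolò and Caciotta–Nicolò; the late chart of
`ConvergesToKerr` also covers the corner of `{t* > τ₀}` near spacelike infinity, where the
development is controlled by that exterior theory rather than by `𝓜_∞`); `𝒟oc` is existential,
pinned from above by the covering clause of `IsLateEmbedding`; the exponents `(s, δ)` are
existential (for `δ ≥ -1/2` the ball only contains perturbations with the ADM parameters of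
`Kerr.data M a r₀`; the printed theorem allows both). **The modulus is `C √dist`, not linear**:
(3.4.7)–(3.4.8) give `≤ C ε₀` for layers of size `𝔍 ≤ ε₀²`, and `𝔍` (§3.3.6) is linear in the
perturbation; nothing sharper is printed (footnote to (3.4.7), Remark 3.4.8). Instance hypotheses
`[Kerr.Facts]`, `[Kerr.SliceFacts]` and the standing `[D.metric.HasLeviCivita]` as in `Stability`.
[cite: KlainermanSzeftel2023, Thm. 1.2.1; Main Theorem §3.4.3 (3.4.7)–(3.4.8)] -/
def klainerman_szeftel_kerr_stability_small_a_cauchy [Kerr.Facts] [Kerr.SliceFacts] : Prop :=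
  ∃ (s : ℕ) (δ : ℝ) (k : ℕ), ∃ a₀ > (0 : ℝ), ∀ (M a : ℝ) (hM : 0 < M), |a| < a₀ * M →
    ∀ r₀ ∈ Set.Ioo (Kerr.rMinus M a) (Kerr.rPlus M a), ∃ ε > (0 : ℝ), ∃ C : ℝ,
      ∀ (D : InitialDataSet 𝓘(ℝ, E3) (Kerr.slice a r₀)) [D.metric.HasLeviCivita],
        D.IsVacuumConstraintSolution →
        InitialDataSet.dataWeightedSobolevEDist s δ D (Kerr.data M a r₀ hM.le) <
          ENNReal.ofReal ε →
        ∀ 𝒟 : VacuumCauchyDevelopment D, 𝒟.IsMaximal →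
          ∃ (M' a' : ℝ) (𝒟oc : Set 𝒟.carrier), Kerr.IsSubextremal M' a' ∧
            𝒟.HasCompleteFutureNullInfinityFar ∧
            𝒟.toSpacetime.ConvergesToKerr 𝒟oc M' a' k ∧
            |M' - M| + |a' - a| ≤ C *
              √(InitialDataSet.dataWeightedSobolevEDist s δ D (Kerr.data M a r₀ hM.le)).toReal

/-- **Thm. 1.2.1's qualitative nearness** from the re-vendored fact: for every tolerance `η > 0`
the data ball can be shrunk (to radius `min ε (η / max C 1)²`) so that the final parameters
satisfy `|M' − M| + |a' − a| ≤ η` — the "`(a_∞, m_∞)` close to the initial ones `(a₀, m₀)`" of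
Klainerman–Szeftel 2023, Thm. 1.2.1, in the `∀ η, ∃ ε` form used by
`SubextremalKerrStabilityConjecture` (`Stability`). Klainerman–Szeftel, PAMQ 19 (2023),
Thm. 1.2.1 and (3.4.8). [cite: KlainermanSzeftel2023, Thm. 1.2.1] -/
theorem klainerman_szeftel_kerr_stability_small_a_cauchy.nearness [Kerr.Facts] [Kerr.SliceFacts]
    (h : klainerman_szeftel_kerr_stability_small_a_cauchy) :
    ∃ (s : ℕ) (δ : ℝ) (k : ℕ), ∃ a₀ > (0 : ℝ), ∀ (M a : ℝ) (hM : 0 < M), |a| < a₀ * M →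
      ∀ r₀ ∈ Set.Ioo (Kerr.rMinus M a) (Kerr.rPlus M a), ∀ η > (0 : ℝ), ∃ ε > (0 : ℝ),
        ∀ (D : InitialDataSet 𝓘(ℝ, E3) (Kerr.slice a r₀)) [D.metric.HasLeviCivita],
          D.IsVacuumConstraintSolution →
          InitialDataSet.dataWeightedSobolevEDist s δ D (Kerr.data M a r₀ hM.le) <
            ENNReal.ofReal ε →
          ∀ 𝒟 : VacuumCauchyDevelopment D, 𝒟.IsMaximal →
            ∃ (M' a' : ℝ) (𝒟oc : Set 𝒟.carrier), Kerr.IsSubextremal M' a' ∧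
              |M' - M| + |a' - a| ≤ η ∧
              𝒟.HasCompleteFutureNullInfinityFar ∧
              𝒟.toSpacetime.ConvergesToKerr 𝒟oc M' a' k := by
  obtain ⟨s, δ, k, a₀, ha₀, H⟩ := h
  refine ⟨s, δ, k, a₀, ha₀, fun M a hM ha r₀ hr₀ η hη ↦ ?_⟩
  obtain ⟨ε, hε, C, HD⟩ := H M a hM ha r₀ hr₀
  have hC : 0 < max C 1 := lt_max_of_lt_right one_pos
  refine ⟨min ε ((η / max C 1) ^ 2), lt_min hε (pow_pos (div_pos hη hC) 2),
    fun D _ hvac hdist 𝒟 hmax ↦ ?_⟩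
  have hdε : InitialDataSet.dataWeightedSobolevEDist s δ D (Kerr.data M a r₀ hM.le) <
      ENNReal.ofReal ε :=
    hdist.trans_le (ENNReal.ofReal_le_ofReal (min_le_left _ _))
  obtain ⟨M', a', 𝒟oc, hsub, hnull, hconv, hpar⟩ := HD D hvac hdε 𝒟 hmax
  refine ⟨M', a', 𝒟oc, hsub, hpar.trans ?_, hnull, hconv⟩
  set d := (InitialDataSet.dataWeightedSobolevEDist s δ D (Kerr.data M a r₀ hM.le)).toReal
  have hd : d < (η / max C 1) ^ 2 :=
    (ENNReal.lt_ofReal_iff_toReal_lt hdist.ne_top).1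
      (hdist.trans_le (ENNReal.ofReal_le_ofReal (min_le_right _ _)))
  have hsd : √d < η / max C 1 := (Real.sqrt_lt' (div_pos hη hC)).2 hd
  calc C * √d ≤ max C 1 * √d := mul_le_mul_of_nonneg_right (le_max_left C 1) (Real.sqrt_nonneg _)
    _ ≤ max C 1 * (η / max C 1) := mul_le_mul_of_nonneg_left hsd.le hC.le
    _ = η := mul_div_cancel₀ η hC.ne'

/-- **At the centre of the data ball the final state is `Kerr(M, a)` itself**: under the
re-vendored fact, for `|a| < a₀ M` and `r₀ ∈ (r₋, r₊)` every maximal vacuum Cauchy development of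
the exact Kerr data `Kerr.data M a r₀` has complete future null infinity from the far region and a
region converging in `Cᵏ` to `g_{M,a}` — the distance of the centre to itself is `0`
(`dataWeightedSobolevEDist_self`), so the modulus `C √0 = 0` pins `(M', a') = (M, a)`. The two
named facts about the Kerr data it consumes enter as hypotheses, exactly as in
`SubextremalKerrStabilityConjecture.kerr_hasCompleteFutureNullInfinityFar` (`Stability`): existence
of the Levi-Civita connection of `h` (`hLC`, fed to `HasLeviCivita.of`) and the vacuum constraints
(`Kerr.data_isVacuumConstraintSolution`, `hvac`). Klainerman–Szeftel, PAMQ 19 (2023), Thm. 1.2.1;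
Dafermos–Rodnianski, arXiv:0811.0354, §5.1 (the Kerr
family). [cite: KlainermanSzeftel2023, Thm. 1.2.1] -/
theorem klainerman_szeftel_kerr_stability_small_a_cauchy.atKerrData [Kerr.Facts] [Kerr.SliceFacts]
    (h : klainerman_szeftel_kerr_stability_small_a_cauchy)
    (hLC : ∀ (M a r₀ : ℝ) (hM : 0 ≤ M),
      (Kerr.data M a r₀ hM).metric.isCovariantDerivativeOn_leviCivitaFun)
    (hvac : ∀ (M a r₀ : ℝ), Kerr.data_isVacuumConstraintSolution M a r₀) :
    ∃ (k : ℕ), ∃ a₀ > (0 : ℝ), ∀ (M a : ℝ) (hM : 0 < M), |a| < a₀ * M →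
      ∀ r₀ ∈ Set.Ioo (Kerr.rMinus M a) (Kerr.rPlus M a),
        ∀ 𝒟 : VacuumCauchyDevelopment (Kerr.data M a r₀ hM.le), 𝒟.IsMaximal →
          𝒟.HasCompleteFutureNullInfinityFar ∧
            ∃ 𝒟oc : Set 𝒟.carrier, 𝒟.toSpacetime.ConvergesToKerr 𝒟oc M a k := by
  obtain ⟨s, δ, k, a₀, ha₀, H⟩ := h
  refine ⟨k, a₀, ha₀, fun M a hM ha r₀ hr₀ 𝒟 hmax ↦ ?_⟩
  obtain ⟨ε, hε, C, HD⟩ := H M a hM ha r₀ hr₀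
  have h0 : InitialDataSet.dataWeightedSobolevEDist s δ (Kerr.data M a r₀ hM.le)
      (Kerr.data M a r₀ hM.le) < ENNReal.ofReal ε := by
    rw [InitialDataSet.dataWeightedSobolevEDist_self]
    exact ENNReal.ofReal_pos.2 hε
  haveI := PseudoRiemannianMetric.HasLeviCivita.of _ (hLC M a r₀ hM.le)
  obtain ⟨M', a', 𝒟oc, -, hnull, hconv, hpar⟩ := HD _ (hvac M a r₀ hM.le) h0 𝒟 hmax
  rw [InitialDataSet.dataWeightedSobolevEDist_self, ENNReal.toReal_zero, Real.sqrt_zero,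
    mul_zero] at hpar
  have hM' : M' = M := by
    refine sub_eq_zero.1 (abs_eq_zero.1 (le_antisymm ?_ (abs_nonneg _)))
    linarith [abs_nonneg (a' - a)]
  have ha' : a' = a := by
    refine sub_eq_zero.1 (abs_eq_zero.1 (le_antisymm ?_ (abs_nonneg _)))
    linarith [abs_nonneg (M' - M)]
  subst hM' ha'
  exact ⟨hnull, 𝒟oc, hconv⟩

end Literature.Geometry.Lorentzian

end
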